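import Summits.NavierStokesRegularity.NavierStokesRegularity.Theses.QuarterTurnRdss
import Literature.Analysis.FluidPDE.TypeIAncientMild

/-!
# Line `period-cell` for crux `QuarterTurnProfileExists` (stmt-NavierStokesRegularity-1100) —
# route `QuarterTurnRdss`, summit NavierStokesRegularity (negative side)

Crux-strategist seat `cstrat-stmt-NavierStokesRegularity-1100-r1` (RESTATED deciding crux, BC2 redirect).
The crux `X = QuarterTurnProfileExists` (∃ `c > 1`, the quarter-turn `R`, a nontrivial genuinely twisted
Type-I `(c,R)`-RDSS ancient mild solution) is cut along the **period-map seam** of rotated discretely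
self-similar dynamics (Bradshaw–Tsai 2017 §1; Chae–Wolf 2017 Def. 1.1; tree
`Literature.Analysis.FluidPDE.exists_concatenation_of_periodic_slabs`): an RDSS ancient solution is the
ℤ-orbit, under the twisted zoom `𝒮h = c R⁻¹ h(cR·)`, of its restriction to ONE model period
`[-1, -c⁻²] × ℝ³`, and that restriction is a **twisted cell** — jointly continuous, bounded, weakly
divergence free, Oseen-mild between all pairs of model times (the KNSS gauge of
`Literature.Analysis.FluidPDE.IsTypeIAncientMild`, which excludes the parasitic `b(t)`), closing up under
the twisted zoom `v(-c⁻², x) = c R⁻¹ v(-1, cRx)` (a fixed point of the twisted period map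
`𝒮⁻¹ ∘ Φ_{1-c⁻²}` of the Navier–Stokes flow). The three registered stubs ARE the three children of the
staged route split (`children.json` of the seat; `route edit --split` is final-cycle-only for this seat, so
until it is applied the children live here as registered stubs of the parent):

* `stub_twistedCellExists` (XL, open; ∃-side, the constructive content): some `c > 1` and the
  quarter-turn `R` admit a twisted cell with `v(-1)` neither a.e. zero nor a.e. `R`-equivariant. NO
  spatial decay is asked (a bounded cell is automatically Type I IN TIME after concatenation). Why easier
  than X: a FINITE-time two-point problem for the NS flow itself — a fixed point of ONE map on ONE space
  (Leray–Schauder / cone fixed point / radii-polynomial certification of a computed cell seeded by the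
  pair → sheet → perpendicular-pair cycle), the infinite concatenation, measurability and the Type-I
  space–time bound being discharged by the other two stubs. Own birth skeleton (defect cells + closing
  lemma): seat file `bc/TwistedCellExists_birth.lean` (workfile `PeriodCellTwistedCellExistsBirth.lean`).
* `stub_twistedCellDecay` (XL, open; ∀-side, Liouville-type): every quarter-turn twisted cell obeys the
  Type-I SPACE–time bound `‖v(t,x)‖ ≤ C₀/(‖x‖ + √(-t))` on the period ("no satellites": the final-time
  singular set of a Type-I-in-time quarter-turn RDSS ancient solution is `{0}`). True in the Liouville
  world (KNSS 2009 Thm 5.3 is its axisymmetric case, NO decay assumed), needed in the blow-up world; gives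
  neither X nor ¬NS alone. Two skeleton lines: `bc/TwistedCellDecay_birth.lean` (Liouville in time +
  zero-datum uniqueness) and `bc/TwistedCellDecay_no-satellites.lean` (eventual shell regularity +
  elementary assembly) (workfiles `PeriodCellTwistedCellDecayBirth.lean`, `…NoSatellites.lean`).
* `stub_twistedCellConcatenates` (L, provable from tree engines; the bridge): a twisted cell with the
  Type-I bound on the period concatenates to an ancient mild `(c,R)`-RDSS Type-I solution with the SAME
  constant and the same slice at `t = -1` (`oseen_zoom_shift`, `oseenMild_of_chain`,
  `isWeaklyDivFree_zoom_in`, `IsTypeIAncientMild.isMildNSSolutionBetween`). Skeleton: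
  `bc/TwistedCellConcatenates_birth.lean` (3 stubs; workfile `PeriodCellTwistedCellConcatenatesBirth.lean`).

Composition `QuarterTurnProfileExists_of` (kernel-checked, no `sorry`; the same proof as the glue evidence
`QuarterTurnRdssQuarterTurnProfileExistsSplit.lean` on stmt-1100): decay constant from stub 2, concatenation
from stub 3, nontriviality and twist transferred through `u(-1) = v(-1)`.

BC2 (c): per-piece probes `piece → X`, `piece → S`, `piece → ¬S` all FAIL (seat files `bc/*_probe.lean`,
rc 1, unsolved goals / aesop exhaustive search failed), converses fail, `exact?` dedup fails; BC3: every
stub of every sub-skeleton fails the same probes (`bc/*_stubprobe.lean`).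

Disproof used: none — no `Disproof.lean` / Negative lemma exists for this crux (`ledger crux ls`,
2026-08-17). Known removals honoured: Chae–Wolf 2017 Thm 1.3 (route support `NearIdentityRemoval`) forces
`c⁴ ≥ λ_*` in stub 1; KNSS 2009 Thm 5.3 kills axisymmetric cells (stub 1's twist clause forbids them).
-/

noncomputable section

namespace Summit.NavierStokesRegularity.NavierStokesRegularity.Cruxes.QuarterTurnProfileExists.PeriodCell

open MeasureTheory Set Function Filter
open Literature.Analysis.FluidPDE

set_option linter.dupNamespace false

/-! ## The three statements of the line (= the staged children of the split, verbatim `children.json`) -/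

/-- ∃-side: a nontrivial, genuinely twisted quarter-turn cell on the model period. -/
def TwistedCellExists : Prop :=
  ∃ c : ℝ, 1 < c ∧ ∃ R : EuclideanSpace ℝ (Fin 3) ≃ₗᵢ[ℝ] EuclideanSpace ℝ (Fin 3), (∀ x : EuclideanSpace ℝ (Fin 3), (R x) 0 = -(x 1) ∧ (R x) 1 = x 0 ∧ (R x) 2 = x 2) ∧ ∃ v : ℝ → EuclideanSpace ℝ (Fin 3) → EuclideanSpace ℝ (Fin 3), (ContinuousOn (Function.uncurry v) (Set.Icc (-1 : ℝ) (-(c ^ 2)⁻¹) ×ˢ Set.univ) ∧ (∃ M : ℝ, ∀ t ∈ Set.Icc (-1 : ℝ) (-(c ^ 2)⁻¹), ∀ x, ‖v t x‖ ≤ M) ∧ (∀ t ∈ Set.Icc (-1 : ℝ) (-(c ^ 2)⁻¹), Literature.Analysis.FluidPDE.IsWeaklyDivFree (v t)) ∧ (∀ s t : ℝ, -1 ≤ s → s < t → t ≤ -(c ^ 2)⁻¹ → ∀ x, v t x = Literature.Analysis.FluidPDE.heatFlow (v s) (t - s) x - Literature.Analysis.FluidPDE.oseenDuhamel 1 s v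 v t x) ∧ (∀ x, v (-(c ^ 2)⁻¹) x = c • R.symm (v (-1) (c • R x)))) ∧ ¬ (v (-1) =ᵐ[volume] 0) ∧ ¬ ((fun x => v (-1) (R x)) =ᵐ[volume] fun x => R (v (-1) x))

/-- ∀-side: quarter-turn twisted cells obey the Type-I space–time bound on the period. -/
def TwistedCellDecay : Prop :=
  ∀ c : ℝ, 1 < c → ∀ R : EuclideanSpace ℝ (Fin 3) ≃ₗᵢ[ℝ] EuclideanSpace ℝ (Fin 3), (∀ x : EuclideanSpace ℝ (Fin 3), (R x) 0 = -(x 1) ∧ (R x) 1 = x 0 ∧ (R x) 2 = x 2) → ∀ v : ℝ → EuclideanSpace ℝ (Fin 3) → EuclideanSpace ℝ (Fin 3), (ContinuousOn (Function.uncurry v) (Set.Icc (-1 : ℝ) (-(c ^ 2)⁻¹) ×ˢ Set.univ) ∧ (∃ M : ℝ, ∀ t ∈ Set.Icc (-1 : ℝ) (-(c ^ 2)⁻¹), ∀ x, ‖v t x‖ ≤ M) ∧ (∀ t ∈ Set.Icc (-1 : ℝ) (-(c ^ 2)⁻¹), Literature.Analysis.FluidPDE.IsWeaklyDivFree (v t))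 ∧ (∀ s t : ℝ, -1 ≤ s → s < t → t ≤ -(c ^ 2)⁻¹ → ∀ x, v t x = Literature.Analysis.FluidPDE.heatFlow (v s) (t - s) x - Literature.Analysis.FluidPDE.oseenDuhamel 1 s v v t x) ∧ (∀ x, v (-(c ^ 2)⁻¹) x = c • R.symm (v (-1) (c • R x)))) → ∃ C₀ : ℝ, ∀ t ∈ Set.Icc (-1 : ℝ) (-(c ^ 2)⁻¹), ∀ x, ‖v t x‖ ≤ C₀ / (‖x‖ + Real.sqrt (-t))

/-- Bridge: a Type-I twisted cell concatenates to a quarter-turn RDSS Type-I ancient mild solution. -/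
def TwistedCellConcatenates : Prop :=
  ∀ c : ℝ, 1 < c → ∀ R : EuclideanSpace ℝ (Fin 3) ≃ₗᵢ[ℝ] EuclideanSpace ℝ (Fin 3), ∀ v : ℝ → EuclideanSpace ℝ (Fin 3) → EuclideanSpace ℝ (Fin 3), (ContinuousOn (Function.uncurry v) (Set.Icc (-1 : ℝ) (-(c ^ 2)⁻¹) ×ˢ Set.univ) ∧ (∃ M : ℝ, ∀ t ∈ Set.Icc (-1 : ℝ) (-(c ^ 2)⁻¹), ∀ x, ‖v t x‖ ≤ M) ∧ (∀ t ∈ Set.Icc (-1 : ℝ) (-(c ^ 2)⁻¹), Literature.Analysis.FluidPDE.IsWeaklyDivFree (v t)) ∧ (∀ s t : ℝ, -1 ≤ s → s < t → t ≤ -(c ^ 2)⁻¹ → ∀ x, v t x = Literature.Analysis.FluidPDE.heatFlow (v s) (t - s) x - Literature.Analysis.FluidPDE.oseenDuhamel 1 s v v t x) ∧ (∀ x, v (-(c ^ 2)⁻¹) x = c • R.symm (v (-1) (c • R x)))) → ∀ C₀ : ℝ, (∀ t ∈ Set.Icc (-1 : ℝ) (-(c ^ 2)⁻¹), ∀ x,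 ‖v t x‖ ≤ C₀ / (‖x‖ + Real.sqrt (-t))) → ∃ u : ℝ → EuclideanSpace ℝ (Fin 3) → EuclideanSpace ℝ (Fin 3), Literature.Analysis.FluidPDE.IsAncientMildSolution 1 u ∧ (∀ t < 0, AEStronglyMeasurable (u t) volume) ∧ Literature.Analysis.FluidPDE.IsRotatedDSS c R u ∧ Literature.Analysis.FluidPDE.HasTypeIDecay C₀ u ∧ u (-1) = v (-1)

namespace Registered

/-- Alias keyed by the registered stub name. -/
abbrev stub_twistedCellExists : Prop := TwistedCellExists
/-- Alias keyed by the registered stub name. -/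
abbrev stub_twistedCellDecay : Prop := TwistedCellDecay
/-- Alias keyed by the registered stub name. -/
abbrev stub_twistedCellConcatenates : Prop := TwistedCellConcatenates

end Registered

/-! ## Registered stubs (the ONLY `sorry`s of the file; literal signatures) -/

/-- **Stub 1 (XL, open; ∃-side = staged child `TwistedCellExists`).** Why it might fail: a
Type-I-in-time Liouville theorem in the quarter-turn RDSS class (KNSS2009 Thm 5.3 axisymmetric case;
Tsai2018 Conj. 8.8–8.9) empties the class; ChaeWolf2017 Thm 1.3 forces `c⁴ ≥ λ_*(M)`; measured cascades
split circulation (x_Γ ≈ 0.25, MckeownEtAl2020) instead of closing up.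
[sources: BradshawTsai2017CPDE §1, §5 OP 5.1; ChaeWolf2017RemovingDSS Def. 1.1, Thm 1.3; KNSS2009 §4 (4.4), Thm 5.3; Tsai2018 Conj. 8.8–8.9; PineauVicol2026 Thm 1.7, Rmk 1.8; MckeownEtAl2020; BrennerHormozPumir2016 §VI] -/
theorem stub_twistedCellExists :
    ∃ c : ℝ, 1 < c ∧ ∃ R : EuclideanSpace ℝ (Fin 3) ≃ₗᵢ[ℝ] EuclideanSpace ℝ (Fin 3), (∀ x : EuclideanSpace ℝ (Fin 3), (R x) 0 = -(x 1) ∧ (R x) 1 = x 0 ∧ (R x) 2 = x 2) ∧ ∃ v : ℝ → EuclideanSpace ℝ (Fin 3) → EuclideanSpace ℝ (Fin 3), (ContinuousOn (Function.uncurry v) (Set.Icc (-1 : ℝ) (-(c ^ 2)⁻¹) ×ˢ Set.univ) ∧ (∃ M : ℝ, ∀ t ∈ Set.Icc (-1 : ℝ) (-(c ^ 2)⁻¹), ∀ x, ‖v t x‖ ≤ M) ∧ (∀ t ∈ Set.Icc (-1 : ℝ) (-(c ^ 2)⁻¹), Literature.Analysis.FluidPDE.IsWeaklyDivFree (v t))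 ∧ (∀ s t : ℝ, -1 ≤ s → s < t → t ≤ -(c ^ 2)⁻¹ → ∀ x, v t x = Literature.Analysis.FluidPDE.heatFlow (v s) (t - s) x - Literature.Analysis.FluidPDE.oseenDuhamel 1 s v v t x) ∧ (∀ x, v (-(c ^ 2)⁻¹) x = c • R.symm (v (-1) (c • R x)))) ∧ ¬ (v (-1) =ᵐ[volume] 0) ∧ ¬ ((fun x => v (-1) (R x)) =ᵐ[volume] fun x => R (v (-1) x)) := by
  sorry

/-- **Stub 2 (XL, open; ∀-side = staged child `TwistedCellDecay`, "no satellites").** Why it might fail: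
a Type-I-in-time RDSS ancient solution may carry a `cR`-invariant spiral of satellite Type-I singularities
at `t = 0` (CKN allows countable final-time singular sets; finiteness is known only under an
`L_∞(L^{3,∞})` bound, Seregin arXiv:1906.06707 after Choe–Wolf–Yang); bounded non-decaying 4-fold backward
self-similar profiles are not excluded in print.
[sources: KNSS2009 Thm 5.3; CaffarelliKohnNirenberg1982; arXiv:1906.06707; AlbrittonBarker2019; ChaeWolf2017RemovingDSS §3; PineauVicol2026; SereginSverak2009] -/
theorem stub_twistedCellDecay :
    ∀ c : ℝ, 1 < c → ∀ R : EuclideanSpace ℝ (Fin 3) ≃ₗᵢ[ℝ] EuclideanSpace ℝ (Fin 3), (∀ x : EuclideanSpace ℝ (Fin 3), (R x) 0 = -(x 1) ∧ (R x) 1 = x 0 ∧ (R x) 2 = x 2) → ∀ v : ℝ → EuclideanSpace ℝ (Fin 3) → EuclideanSpace ℝ (Fin 3), (ContinuousOn (Function.uncurry v) (Set.Icc (-1 : ℝ) (-(c ^ 2)⁻¹) ×ˢ Set.univ) ∧ (∃ M : ℝ, ∀ t ∈ Set.Icc (-1 : ℝ) (-(c ^ 2)⁻¹), ∀ x, ‖v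 t x‖ ≤ M) ∧ (∀ t ∈ Set.Icc (-1 : ℝ) (-(c ^ 2)⁻¹), Literature.Analysis.FluidPDE.IsWeaklyDivFree (v t)) ∧ (∀ s t : ℝ, -1 ≤ s → s < t → t ≤ -(c ^ 2)⁻¹ → ∀ x, v t x = Literature.Analysis.FluidPDE.heatFlow (v s) (t - s) x - Literature.Analysis.FluidPDE.oseenDuhamel 1 s v v t x) ∧ (∀ x, v (-(c ^ 2)⁻¹) x = c • R.symm (v (-1) (c • R x)))) → ∃ C₀ : ℝ, ∀ t ∈ Set.Icc (-1 : ℝ) (-(c ^ 2)⁻¹), ∀ x, ‖v t x‖ ≤ C₀ / (‖x‖ + Real.sqrt (-t)) := by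
  sorry

/-- **Stub 3 (L, provable; bridge = staged child `TwistedCellConcatenates`).** Two-sided ℤ-concatenation
of the cell by twisted zooms in the Oseen gauge (forward half = tree `exists_concatenation_of_periodic_slabs`),
the Type-I bound slab by slab (invariance of `C₀/(‖x‖+√(-t))` under the twisted zoom), duality-form
mildness verbatim as `IsTypeIAncientMild.isMildNSSolutionBetween`. Why it might fail (Lean only):
bookkeeping of ℤ-indexed slabs and negative powers of `R`.
[sources: BradshawTsai2017CPDE §1; ChaeWolf2017RemovingDSS Def. 1.1; KNSS2009 §4, Lemma 6.1; tree RdssPeriodConcatenation.lean, TypeIAncientMild.lean] -/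
theorem stub_twistedCellConcatenates :
    ∀ c : ℝ, 1 < c → ∀ R : EuclideanSpace ℝ (Fin 3) ≃ₗᵢ[ℝ] EuclideanSpace ℝ (Fin 3), ∀ v : ℝ → EuclideanSpace ℝ (Fin 3) → EuclideanSpace ℝ (Fin 3), (ContinuousOn (Function.uncurry v) (Set.Icc (-1 : ℝ) (-(c ^ 2)⁻¹) ×ˢ Set.univ) ∧ (∃ M : ℝ, ∀ t ∈ Set.Icc (-1 : ℝ) (-(c ^ 2)⁻¹), ∀ x, ‖v t x‖ ≤ M) ∧ (∀ t ∈ Set.Icc (-1 : ℝ) (-(c ^ 2)⁻¹), Literature.Analysis.FluidPDE.IsWeaklyDivFree (v t)) ∧ (∀ s t : ℝ, -1 ≤ s → s < t → t ≤ -(c ^ 2)⁻¹ → ∀ x, v t x = Literature.Analysis.FluidPDE.heatFlow (v s) (t - s) x - Literature.Analysis.FluidPDE.oseenDuhamel 1 s v v t x) ∧ (∀ x, v (-(c ^ 2)⁻¹) x = c • R.symm (v (-1) (c • R x)))) → ∀ C₀ : ℝ, (∀ t ∈ Set.Icc (-1 : ℝ) (-(c ^ 2)⁻¹), ∀ x,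 ‖v t x‖ ≤ C₀ / (‖x‖ + Real.sqrt (-t))) → ∃ u : ℝ → EuclideanSpace ℝ (Fin 3) → EuclideanSpace ℝ (Fin 3), Literature.Analysis.FluidPDE.IsAncientMildSolution 1 u ∧ (∀ t < 0, AEStronglyMeasurable (u t) volume) ∧ Literature.Analysis.FluidPDE.IsRotatedDSS c R u ∧ Literature.Analysis.FluidPDE.HasTypeIDecay C₀ u ∧ u (-1) = v (-1) := by
  sorry

/-! ## Composition (kernel-checked; no `sorry` in the closure of `QuarterTurnProfileExists_of`) -/

/-- **Composition: the three stubs imply the crux `QuarterTurnRdss.QuarterTurnProfileExists` BY NAME.**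
Hypotheses keyed by the registered stub names. -/
theorem QuarterTurnProfileExists_of (h₁ : Registered.stub_twistedCellExists)
    (h₂ : Registered.stub_twistedCellDecay) (h₃ : Registered.stub_twistedCellConcatenates) :
    _root_.Summit.NavierStokesRegularity.NavierStokesRegularity.Theses.QuarterTurnRdss.QuarterTurnProfileExists := by
  dsimp only [Registered.stub_twistedCellExists, TwistedCellExists, Registered.stub_twistedCellDecay,
    TwistedCellDecay, Registered.stub_twistedCellConcatenates, TwistedCellConcatenates] at h₁ h₂ h₃
  obtain ⟨c, hc, R, hR, v, hcell, hnt, htw⟩ := h₁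
  obtain ⟨C₀, hdec⟩ := h₂ c hc R hR v hcell
  obtain ⟨u, hmild, hmeas, hrdss, hTI, hu1⟩ := h₃ c hc R v hcell C₀ hdec
  refine ⟨c, hc, R, hR, u, hmild, hmeas, hrdss, ⟨C₀, hTI⟩, ?_, ?_⟩
  · intro h
    exact hnt (hu1 ▸ h (-1) (by norm_num))
  · intro h
    have h1 := h (-1) (by norm_num)
    rw [hu1] at h1
    exact htw h1

/-! ## Wiring check -/

/-- A local copy of the crux (so that exactly ONE theorem of this file concludes the crux constant itself). -/
def QuarterTurnProfileExists' : Prop :=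
  _root_.Summit.NavierStokesRegularity.NavierStokesRegularity.Theses.QuarterTurnRdss.QuarterTurnProfileExists

/-- The sorried stubs, with their LITERAL signatures, feed `QuarterTurnProfileExists_of` exactly as
stated (this declaration inherits the three `sorry`s; `QuarterTurnProfileExists_of` itself is closed). -/
theorem quarterTurnProfileExists_of_stubs : QuarterTurnProfileExists' :=
  QuarterTurnProfileExists_of stub_twistedCellExists stub_twistedCellDecay stub_twistedCellConcatenates

end Summit.NavierStokesRegularity.NavierStokesRegularity.Cruxes.QuarterTurnProfileExists.PeriodCell

end
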